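import Summits.QuantumFields.YangMills.Theorems.DiagonalMirrorRPRTwistLettersDefs
import Summits.QuantumFields.YangMills.Theorems.DiagonalMirrorRPROddTorusSwapPairingDefs
import Summits.QuantumFields.YangMills.Theorems.DiagonalMirrorRPRWilsonDiagonalModelMirrorFamily
import Summits.QuantumFields.YangMills.Theorems.DiagonalMirrorRPRFamObsGrowth
import Summits.QuantumFields.YangMills.Theorems.DiagonalMirrorRPRSignTwistedCore
import Summits.QuantumFields.YangMills.Theorems.DiagonalMirrorRPRWilsonDiagonalModelModel

/-!
# Crux `WeakCouplingHypercubicLimitRP` (stmt-QuantumFields-27398) / aside `DiagonalMirrorRPR` (stmt-QuantumFields-10604), door B: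
# the TEPID LETTER R2♭ `DiagTepid` and the door-B core re-run on it (re-homed, sorry-free)

Helper file (`--supports stmt-QuantumFields-27398 --as helper`) of the hand `hand-10604-wilsonDiagModel-2` g2, docket director-ym O4 WORD 32 (2) /
O4 WORD 34 (3) (b1): LAND the sorry-free "tepid package" of the crux-ideate seat «spectral-transfer» g1
(`pub/ym-o4cluster/cruxidea-10604-r2/spectral-transfer/Sketch-spectral-transfer-g1.lean`, sha16 `1eda3b652b23f4e0`, §1, critic idea-crit-9 g13
booking O4 WORD 32 (1)) as ONE Theorems file in the door-B namespace `…Cruxes.DiagonalMirrorRPR.SignTwistedDiagonalTrace` (where the letters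
`OddTwistGap` / `DiagLukewarm` of `…TwistLettersDefs` and `core_of` of `…SignTwistedCore` live; NOT the ideator's `…SpectralTransferG1`).  Bodies
and docstrings of the four declarations are the seat's, byte-for-byte; the stub `stub_diagCluster_of_rpSpectral` and the defs `DiagCluster` /
`SlowModeVisible` are NOT here (O4 WORD 32 (2)).  It closes nothing by itself.

* `DiagTepid 𝔪` — R2♭: for some `θ < 1/2` and EVERY `η > 0`, eventually `Σ (sp/top)^{2t} + Σ (sm/top)^{2t} ≤ exp(η a_k side_k)` for `t ≥ θ side_k`
  (sub-exponential heat trace in the physical side) — weaker than R2 `DiagLukewarm` (`diagTepid_of_diagLukewarm`) and exactly what the core consumes;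
* `core_of_tepid : OddTwistGap 𝔪 → DiagTepid 𝔪 → Growth r sch → OddTorusSwapPairingLiminf r sch` — the door-B core re-run on R2♭;
* `oddTorusSwapPairingLiminf_of_tepidLetters` — the `∃ 𝔪` form;
* `oddTorusSwapPairingLiminf_of_wilson_tepid` (added here, one line) — the same READ ON THE LANDED MODEL `WilsonDiagonal.wilsonDiagonalModel r sch hβ`
  (p829712): `OddTwistGap (wilsonDiagonalModel …) → DiagTepid (wilsonDiagonalModel …) → Growth r sch → OddTorusSwapPairingLiminf r sch`, so that the
  letters of record are statements about Wilson's diagonal transfer model and not about the (junk-inhabitable) bare interface.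

HONEST FRAMING: re-homing of proved reductions; NO letter is proved (R1 `OddTwistGap`, R2♭ `DiagTepid` remain open weak-coupling physics); D1′, S6i,
⟨27398⟩ (0∕2) and the aside ⟨10604⟩ are OPEN; nothing here bears on the summit; the Yang–Mills mass gap is NOT proved here or anywhere in the tree.
No instance, no notation, `autoImplicit false`.

References: Osterwalder–Seiler, Ann. Phys. 110 (1978) §2–3; Fröhlich–Israel–Lieb–Simon, Comm. Math. Phys. 62 (1978) Thm 2.1; Seiler LNP 159 Ch. 2.
-/

set_option autoImplicit false

noncomputable section

open scoped SchwartzMap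
open MeasureTheory Filter Topology
open Literature.MathematicalPhysics.QuantumLattice Literature.MathematicalPhysics.AQFT
  Literature.MathematicalPhysics.QuantumFieldTheory

namespace Summit.QuantumFields.YangMills.Cruxes.DiagonalMirrorRPR.SignTwistedDiagonalTrace

variable {G : Type} [Group G] [TopologicalSpace G] [IsTopologicalGroup G] [CompactSpace G]
  [MeasurableSpace G] [BorelSpace G]

/-! ## §1 R2 retyped: the sub-exponential heat-trace letter `DiagTepid` (seat spectral-transfer g1 §1, verbatim) -/

section Tepid

variable {r : LatticeRep G} {sch : SpeciesScheme (YMSpecies G)}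

/-- **R2♭ `DiagTepid`** (weaker than `DiagLukewarm`, and exactly what `core_of` consumes): for some temporal aspect
`θ < 1/2` and EVERY `η > 0`, eventually in `k`, the normalised diagonal heat trace at `2t ≥ 2θ·side_k` steps is
`≤ exp(η · a_k · side_k)` — a sub-exponential allowance in the physical side `ℓ_k = a_k side_k` instead of a constant. -/
def DiagTepid (𝔪 : DiagonalSliceModel r sch) : Prop :=
  ∃ θ : ℝ, 0 < θ ∧ θ < 1 / 2 ∧ ∀ η : ℝ, 0 < η → ∀ᶠ k in atTop, ∀ t : ℕ, θ * (sch.side k : ℝ) ≤ (t : ℝ) →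
    ∑' j, (𝔪.sp k j / 𝔪.top k) ^ (2 * t) + ∑' j, (𝔪.sm k j / 𝔪.top k) ^ (2 * t) ≤
      Real.exp (η * (sch.a k * sch.side k))

/-- `DiagLukewarm ⇒ DiagTepid` (PROVED): a constant is eventually below `exp(η a_k side_k)` because `a_k side_k → ∞`. -/
theorem diagTepid_of_diagLukewarm (𝔪 : DiagonalSliceModel r sch) (h : DiagLukewarm 𝔪) : DiagTepid 𝔪 := by
  obtain ⟨θ, hθ0, hθ, C, hC⟩ := h
  refine ⟨θ, hθ0, hθ, fun η hη => ?_⟩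
  have hx : Tendsto (fun k => sch.a k * (sch.side k : ℝ)) atTop atTop := tendsto_a_mul_side' sch
  have hev : ∀ᶠ k in atTop, C ≤ Real.exp (η * (sch.a k * sch.side k)) :=
    (Real.tendsto_exp_atTop.comp (hx.const_mul_atTop hη)).eventually_ge_atTop C
  filter_upwards [hC, hev] with k hk hCk t ht
  exact (hk t ht).trans hCk

set_option maxHeartbeats 1600000 in
/-- **`core_of_tepid` (PROVED — R2 retyped): the landed core `core_of` (✓ `…DiagonalMirrorRPRSignTwistedCore`) re-run with the
sub-exponential letter `DiagTepid` in place of `DiagLukewarm`.**  The constant `C` of R2 entered `core_of` only through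
`2·C·B_k²·g^{S−2d−2t} ≤ ε_k → 0` and `C·g^{S−2t} ≤ 1/2`; with `C ↦ exp(η a_k S_k)`, `η := γ(1−2θ)/4`, both survive (`tendsto_penalty_zero` at
`κ := γ(1−2θ) − η`). -/
theorem core_of_tepid (𝔪 : DiagonalSliceModel r sch) (hR1 : OddTwistGap 𝔪) (hR2 : DiagTepid 𝔪) (hG : Growth r sch) :
    OddTorusSwapPairingLiminf r sch := by
  intro m n c f σf hf _hdisj hσ
  let F : ReflectedFamily :=
    ⟨m, n, c, f, σf, fun i j => (hf i j).1, fun i j => (hf i j).2, hσ⟩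
  change 0 ≤ Filter.liminf (fun k => gramPairing r sch F k) atTop
  obtain ⟨γ, hγ, hgap⟩ := hR1
  obtain ⟨θ, hθ0, hθ, htepid⟩ := hR2
  obtain ⟨R, hR⟩ := 𝔪.depth_le F
  obtain ⟨K, P, Q, hB⟩ := famObs_supGrowth hG.1 F
  -- asymptotics of the scheme
  have hx : Tendsto (fun k => sch.a k * (sch.side k : ℝ)) atTop atTop := tendsto_a_mul_side' sch
  have ha1 : ∀ᶠ k in atTop, sch.a k ≤ 1 :=
    ((tendsto_order.1 sch.tendsto_a).2 1 one_pos).mono fun k hk => hk.le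
  have hSinf : Tendsto (fun k => (sch.side k : ℝ)) atTop atTop := by
    refine tendsto_atTop_mono' atTop ?_ hx
    filter_upwards [ha1] with k hk
    exact mul_le_of_le_one_left (Nat.cast_nonneg _) hk
  have h12θ : 0 < 1 - 2 * θ := by linarith
  -- the tepid rate `η` and the surviving penalty rate `κ`
  set η : ℝ := γ * (1 - 2 * θ) / 4 with hη_def
  have hη : 0 < η := by rw [hη_def]; positivity
  set κ : ℝ := γ * (1 - 2 * θ) - η with hκ_def
  have hγθ : 0 < γ * (1 - 2 * θ) := mul_pos hγ h12θ
  have hκ : 0 < κ := by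
    have : κ = 3 * (γ * (1 - 2 * θ)) / 4 := by rw [hκ_def, hη_def]; ring
    rw [this]; positivity
  have hluke := htepid η hη
  -- the `k`-dependent heat-trace allowance replacing the constant `C`
  let Cf : ℕ → ℝ := fun k => Real.exp (η * (sch.a k * sch.side k))
  -- the penalty sequence
  let ε : ℕ → ℝ := fun k => (2 * Real.exp (γ * (2 * R + 2))) * (K ^ 2 * ((sch.a k)⁻¹ ^ (2 * P) *
    (sch.a k * sch.side k) ^ (2 * Q) * Real.exp (-(κ * (sch.a k * sch.side k)))))
  have hε : Tendsto ε atTop (𝓝 0) := by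
    have := (tendsto_penalty_zero sch hG.2 (K ^ 2) κ hκ (2 * P) (2 * Q)).const_mul (2 * Real.exp (γ * (2 * R + 2)))
    rw [mul_zero] at this
    exact this
  refine liminf_nonneg_of_eventually_ge hε ?_
  -- eventual side conditions
  have hS1 : ∀ᶠ k in atTop, 1 ≤ θ * (sch.side k : ℝ) := (hSinf.const_mul_atTop hθ0).eventually_ge_atTop 1
  have hroom : ∀ᶠ k in atTop, 2 * R + 4 ≤ (1 - 2 * θ) * (sch.a k * sch.side k) :=
    (hx.const_mul_atTop h12θ).eventually_ge_atTop _
  have hhalf : ∀ᶠ k in atTop,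
      Cf k * Real.exp (-(γ * ((1 - 2 * θ) * (sch.a k * sch.side k) - 2))) ≤ 1 / 2 := by
    -- `Cf k · exp(−γ((1−2θ)x − 2)) = exp(2γ) · exp(−(γ(1−2θ) − η) x)` with `γ(1−2θ) − η = κ + … > 0`
    have hrate : 0 < γ * (1 - 2 * θ) - η := hκ
    have h1 : Tendsto (fun k => (γ * (1 - 2 * θ) - η) * (sch.a k * sch.side k)) atTop atTop :=
      hx.const_mul_atTop hrate
    have h2 : Tendsto (fun k => Real.exp (2 * γ) * Real.exp (-((γ * (1 - 2 * θ) - η) * (sch.a k * sch.side k))))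
        atTop (𝓝 (Real.exp (2 * γ) * 0)) :=
      (Real.tendsto_exp_atBot.comp (tendsto_neg_atTop_atBot.comp h1)).const_mul _
    rw [mul_zero] at h2
    have h3 := ((tendsto_order.1 h2).2 (1 / 2) (by norm_num)).mono fun k hk => hk.le
    filter_upwards [h3] with k hk
    have heq : Cf k * Real.exp (-(γ * ((1 - 2 * θ) * (sch.a k * sch.side k) - 2))) =
        Real.exp (2 * γ) * Real.exp (-((γ * (1 - 2 * θ) - η) * (sch.a k * sch.side k))) := by
      simp only [Cf, ← Real.exp_add]; congr 1; ring
    rw [heq]; exact hk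
  filter_upwards [hgap, hluke, hR, hB, 𝔪.pairing_eq F, 𝔪.weight_dom F, ha1, hS1, hroom, hhalf] with k hgapk hlukek
    hRk hBk hpairk hdomk ha1k hS1k hroomk hhalfk
  -- notation at step `k`
  obtain ⟨h2d, hpairk⟩ := hpairk
  set S : ℕ := sch.side k with hS_def
  set d : ℕ := 𝔪.depth F k with hd_def
  set a : ℝ := sch.a k with ha_def
  have ha0 : 0 < a := sch.a_pos k
  set C : ℝ := Cf k with hC_def
  set t : ℕ := ⌈θ * (S : ℝ)⌉₊ with ht_def
  have htS : θ * (S : ℝ) ≤ (t : ℝ) := Nat.le_ceil _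
  have htlt : (t : ℝ) < θ * S + 1 := Nat.ceil_lt_add_one (by positivity)
  have ht1 : 1 ≤ t := by
    have : (1 : ℝ) ≤ t := le_trans hS1k htS
    exact_mod_cast this
  -- room: `2t + 2d ≤ S`
  have htd : 2 * t + 2 * d ≤ S := by
    have hreal : ((2 * t + 2 * d : ℕ) : ℝ) < (S : ℝ) := by
      push_cast
      have h1 : a * (2 * (t : ℝ) + 2 * d) < a * (2 * (θ * S + 1)) + 2 * R := by nlinarith
      have h2 : a * (2 * (θ * S + 1)) + 2 * R ≤ a * S := by nlinarith
      have h3 : a * (2 * (t : ℝ) + 2 * d) < a * S := lt_of_lt_of_le h1 h2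
      exact lt_of_mul_lt_mul_left h3 ha0.le
    exact_mod_cast hreal.le
  -- the gap factor
  set g : ℝ := Real.exp (-(γ * a)) with hg_def
  have hg0 : 0 ≤ g := (Real.exp_pos _).le
  have hg1 : g ≤ 1 := by rw [hg_def, Real.exp_le_one_iff]; nlinarith
  have hsmg : ∀ j, 𝔪.sm k j ≤ g * 𝔪.top k := hgapk
  obtain ⟨W, hW⟩ := 𝔪.w_bdd F k
  -- `C = Cf k > 0`
  have hC0 : 0 ≤ C := (Real.exp_pos _).le
  -- `g^n = exp(−γ a n)` and the two exponent estimates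
  have hgpow : ∀ n : ℕ, g ^ n = Real.exp (-(γ * (a * n))) := by
    intro n; rw [hg_def, ← Real.exp_nat_mul]; congr 1; ring
  have hat : a * (t : ℝ) ≤ θ * (a * S) + a := by nlinarith [mul_le_mul_of_nonneg_left htlt.le ha0.le]
  have hhalfk' : C * g ^ (S - 2 * t) ≤ 1 / 2 := by
    refine le_trans (mul_le_mul_of_nonneg_left ?_ hC0) hhalfk
    rw [hgpow, Real.exp_le_exp]
    have : ((S - 2 * t : ℕ) : ℝ) = S - 2 * t := by push_cast [show 2 * t ≤ S by omega]; ring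
    rw [this]
    have key : (1 - 2 * θ) * (a * S) - 2 ≤ a * (S - 2 * t) := by nlinarith
    have := mul_le_mul_of_nonneg_left key hγ.le
    linarith
  -- sup bound
  set Bk : ℝ := K * a⁻¹ ^ P * (a * S) ^ Q with hBk_def
  -- apply the per-`k` core inequality
  have hcore := pairing_lower_bound (p := gramPairing r sch F k) (𝔪.top_pos k) (𝔪.sp_nonneg k) (𝔪.sm_nonneg k)
    (𝔪.sp_le k) (𝔪.sm_le k) hsmg hg0 (𝔪.summable_sp k) (𝔪.summable_sm k) (𝔪.wp_nonneg F k) (𝔪.wm_nonneg F k)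
    hW (𝔪.exists_even_top k) ht1 htd (hlukek t htS)
    (by simpa only [mul_add, Nat.cast_add] using hlukek (t + d) (by push_cast; linarith))
    hhalfk' hpairk (hdomk t Bk hBk)
  refine le_trans ?_ hcore
  -- `ε_k` dominates the per-`k` penalty: `C · g^{S−2d−2t} ≤ exp(γ(2R+2)) · exp(−κ a S)`
  have hexp : C * g ^ (S - 2 * d - 2 * t) ≤ Real.exp (γ * (2 * R + 2)) * Real.exp (-(κ * (a * S))) := by
    rw [hgpow, hC_def]
    simp only [Cf, ← Real.exp_add, Real.exp_le_exp]
    have : ((S - 2 * d - 2 * t : ℕ) : ℝ) = S - 2 * d - 2 * t := by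
      rw [Nat.sub_sub, Nat.cast_sub (by omega)]; push_cast; ring
    rw [this, hκ_def]
    have had : a * d ≤ R := hRk
    have key : (1 - 2 * θ) * (a * S) - (2 * R + 2) ≤ a * (S - 2 * d - 2 * t) := by nlinarith
    have hmain := mul_le_mul_of_nonneg_left key hγ.le
    -- goal: η * (a * S) + -(γ * (a * (S − 2d − 2t))) ≤ γ(2R+2) + -(κ (a S)), where κ = γ(1−2θ) − η
    have : η * (sch.a k * (sch.side k : ℝ)) = η * (a * S) := by rw [ha_def, hS_def]
    nlinarith [hmain, this]
  have hBk2 : Bk ^ 2 = K ^ 2 * (a⁻¹ ^ (2 * P) * (a * S) ^ (2 * Q)) := by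
    rw [hBk_def]; ring
  have hfinal : 2 * C * Bk ^ 2 * g ^ (S - 2 * d - 2 * t) ≤ ε k := by
    have hB2 : 0 ≤ 2 * Bk ^ 2 := by positivity
    calc 2 * C * Bk ^ 2 * g ^ (S - 2 * d - 2 * t)
        = 2 * Bk ^ 2 * (C * g ^ (S - 2 * d - 2 * t)) := by ring
      _ ≤ 2 * Bk ^ 2 * (Real.exp (γ * (2 * R + 2)) * Real.exp (-(κ * (a * S)))) :=
          mul_le_mul_of_nonneg_left hexp hB2
      _ = ε k := by simp only [ε, hBk2]; ring
  linarith

/-- `TwistLetters`-shaped packaging with the tepid letter: `(∃ 𝔪, OddTwistGap 𝔪 ∧ DiagTepid 𝔪) → Growth → D1′-socket` (PROVED). -/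
theorem oddTorusSwapPairingLiminf_of_tepidLetters
    (h : ∃ 𝔪 : DiagonalSliceModel r sch, OddTwistGap 𝔪 ∧ DiagTepid 𝔪) (hG : Growth r sch) :
    OddTorusSwapPairingLiminf r sch := by
  obtain ⟨𝔪, h1, h2⟩ := h
  exact core_of_tepid 𝔪 h1 h2 hG



end Tepid

/-! ## §2 The reduction read on the landed Wilson diagonal transfer model -/

section OnModel

/-- **Door B on the landed model**: the letters R1 `OddTwistGap` and R2♭ `DiagTepid` READ ON `WilsonDiagonal.wilsonDiagonalModel r sch hβ` (p829712),
together with the scheme growth clause, give the line's lattice statement `OddTorusSwapPairingLiminf r sch`. -/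
theorem oddTorusSwapPairingLiminf_of_wilson_tepid (r : LatticeRep G) (sch : SpeciesScheme (YMSpecies G)) (hβ : ∀ k, 0 ≤ sch.β k)
    (hR1 : OddTwistGap (WilsonDiagonal.wilsonDiagonalModel r sch hβ)) (hR2 : DiagTepid (WilsonDiagonal.wilsonDiagonalModel r sch hβ))
    (hG : Growth r sch) : OddTorusSwapPairingLiminf r sch :=
  core_of_tepid _ hR1 hR2 hG

end OnModel

end Summit.QuantumFields.YangMills.Cruxes.DiagonalMirrorRPR.SignTwistedDiagonalTrace

end
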